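import Mathlib.Probability.Distributions.Gaussian.Multivariate
import Mathlib.Probability.Moments.Basic

/-!
# GaussianSmallField — Gaussian tails about the mean and the small-field box with per-site thresholds (Mathlib-only)

Cell pub-balaban, SURGE NODE PROVER #06 (pv06 lineage, U5 adversarial referee), row PV06-SMALLFIELD-SPLIT*, answering
the B10 sub-cell's request (b10-g13, XREAD-REQUEST of `B10Eq47Volume.lean` v1, item (2)): «split § SmallField
(Mathlib-only) into its own leaf so Gaussian-volume consumers become LIVE in staging».

WHAT THIS FILE IS.  A leaf whose import cone is Mathlib alone, carrying the measure-generic small-field lemmas in their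
natural generality — Gaussian tails ABOUT AN ARBITRARY MEAN `m` with a variance BOUND `v ≤ C`, the coordinate marginal of
`multivariateGaussian μ S` for an arbitrary mean vector `μ` and index type `ι`, and the small-field box with PER-SITE
thresholds `p i` and PER-SITE variance bounds `C i` (the form in which Šidák's inequality is printed: one threshold per
coordinate).  The uniform, mean-zero specialisations (`p i = p`, `C i = C`, `m = 0`) are the lemmas of
`…Balaban1983to89.T4TerritoryReflection` § SmallField, which landed first and are NOT restated here (that module keeps
them; its import cone runs through the T4 territory chain, which is why a Mathlib-only home is wanted by consumers that
only need the Gaussian box):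

* §1 one-site tails about the mean (Chernoff with the Gaussian mgf `t ↦ exp(mt + vt²/2)` at `t = ±p/C`):
  `gaussianReal_real_mean_add_le_le` (`P(N(m,v) ≥ m + p) ≤ e^{−p²/(2C)}`), `gaussianReal_real_le_mean_sub_le`,
  `gaussianReal_real_abs_sub_mean_ge_le` (`P(|N(m,v) − m| ≥ p) ≤ 2e^{−p²/(2C)}`), `gaussianReal_real_abs_sub_mean_le_ge`
  (`P(|N(m,v) − m| ≤ p) ≥ 1 − 2e^{−p²/(2C)}`), all for `v ≤ C`, `p ≥ 0`;
* §2 `multivariateGaussian_real_coord_abs_sub_le` — the coordinate marginal on the slab `|x i − μ i| ≤ p` is the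
  one-dimensional Gaussian probability (Mathlib's `measurePreserving_eval_multivariateGaussian`);
* §3 the hypothesis SHAPE `SidakInequality` — ŠIDÁK'S INEQUALITY [Sidak1967] as quoted in [SchechtmanSchlumprechtZinn1998]
  p. 347, the ONE published theorem of this file, NOT proved, NOT asserted, consumed only as a binder.  It is the SAME
  cited fact as `T4TerritoryReflection.SidakInequality` (byte-identical body), re-filed here so that Mathlib-only
  consumers can name it; with both modules imported the two are interchangeable by `Iff.rfl` / `exact h`;
* §3 `smallFieldBox_real_ge_sites` — THE SMALL-FIELD MASS OF THE BOX WITH PER-SITE THRESHOLDS, kernel GIVEN Šidák: for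
  a positive semidefinite covariance `S` on `k` sites with `S i i ≤ C i`, thresholds `p i > 0` in the regime
  `2e^{−pᵢ²/(2Cᵢ)} ≤ ½`:  `exp(−2 Σᵢ 2e^{−pᵢ²/(2Cᵢ)}) ≤ P_{N(0,S)}(|xᵢ| ≤ pᵢ ∀ i)`; the uniform case `pᵢ = p`,
  `Cᵢ = C` gives `exp(−4e^{−p²/(2C)}·k)` (three lines at the call site: instantiate with constant functions, then
  `simp [Finset.sum_const]` and `ring` in the exponent) = `T4TerritoryReflection.smallFieldBox_real_ge`.

HONEST SCOPE.  Pure measure theory over Mathlib's `gaussianReal` and `multivariateGaussian`; nothing of Bałaban's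
series is transcribed or asserted here; no axioms are declared and every proof is complete; the only non-kernel content
is the binder `SidakInequality` (Mathlib has no Gaussian correlation inequality).  NOT summit progress.

References (for the one cited hypothesis shape): [Sidak1967] Z. Šidák, Rectangular confidence regions for the means of
multivariate normal distributions, J. Amer. Statist. Assoc. 62 (1967) 626–633, Corollary 1; [SchechtmanSchlumprechtZinn1998]
G. Schechtman, Th. Schlumprecht, J. Zinn, On the Gaussian measure of the intersection, Ann. Probab. 26 (1998) 346–357,
p. 347 (the quotation in the docstring of `SidakInequality`).
-/

open MeasureTheory ProbabilityTheory
open scoped NNReal ENNReal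

namespace Literature.MathematicalPhysics.QuantumFieldTheory.Balaban1983to89.GaussianSmallField

/-! ## §1 One-dimensional Gaussian tails about the mean, with a variance bound -/

/-- **ONE-SITE UPPER TAIL ABOUT THE MEAN** (Chernoff at parameter `p/C` with the Gaussian mgf; stated with a variance
BOUND `v ≤ C` so that degenerate coordinates need no case split): `P(N(m,v) ≥ m + p) ≤ e^{−p²/(2C)}`. [folklore] -/
theorem gaussianReal_real_mean_add_le_le {m : ℝ} {v : ℝ≥0} {C p : ℝ} (hC : 0 < C) (hv : (v : ℝ) ≤ C) (hp : 0 ≤ p) :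
    (gaussianReal m v).real {x : ℝ | m + p ≤ x} ≤ Real.exp (-(p ^ 2 / (2 * C))) := by
  have ht : 0 ≤ p / C := div_nonneg hp hC.le
  have h := measure_ge_le_exp_mul_mgf (μ := gaussianReal m v) (X := id) (m + p) ht
    (integrable_exp_mul_gaussianReal (μ := m) (v := v) _)
  have hmgf : mgf id (gaussianReal m v) (p / C) = Real.exp (m * (p / C) + v * (p / C) ^ 2 / 2) := by
    rw [congrFun mgf_id_gaussianReal (p / C)]
  rw [hmgf, ← Real.exp_add] at h
  refine h.trans (Real.exp_le_exp.2 ?_)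
  have h1 : (v : ℝ) * (p / C) ^ 2 / 2 ≤ C * (p / C) ^ 2 / 2 := by gcongr
  have h2 : -(p / C) * (m + p) + (m * (p / C) + C * (p / C) ^ 2 / 2) = -(p ^ 2 / (2 * C)) := by
    field_simp
    ring
  simp only [id] at h ⊢
  linarith

/-- **ONE-SITE LOWER TAIL ABOUT THE MEAN**: `P(N(m,v) ≤ m − p) ≤ e^{−p²/(2C)}` for `v ≤ C`, `p ≥ 0`. [folklore] -/
theorem gaussianReal_real_le_mean_sub_le {m : ℝ} {v : ℝ≥0} {C p : ℝ} (hC : 0 < C) (hv : (v : ℝ) ≤ C) (hp : 0 ≤ p) :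
    (gaussianReal m v).real {x : ℝ | x ≤ m - p} ≤ Real.exp (-(p ^ 2 / (2 * C))) := by
  have ht : -(p / C) ≤ 0 := by
    have : 0 ≤ p / C := div_nonneg hp hC.le
    linarith
  have h := measure_le_le_exp_mul_mgf (μ := gaussianReal m v) (X := id) (m - p) ht
    (integrable_exp_mul_gaussianReal (μ := m) (v := v) _)
  have hmgf : mgf id (gaussianReal m v) (-(p / C)) = Real.exp (m * (-(p / C)) + v * (-(p / C)) ^ 2 / 2) := by
    rw [congrFun mgf_id_gaussianReal (-(p / C))]
  rw [hmgf, ← Real.exp_add] at h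
  refine h.trans (Real.exp_le_exp.2 ?_)
  have h1 : (v : ℝ) * (-(p / C)) ^ 2 / 2 ≤ C * (-(p / C)) ^ 2 / 2 := by gcongr
  have h2 : -(-(p / C)) * (m - p) + (m * (-(p / C)) + C * (-(p / C)) ^ 2 / 2) = -(p ^ 2 / (2 * C)) := by
    field_simp
    ring
  simp only [id] at h ⊢
  linarith

/-- **ONE-SITE TWO-SIDED TAIL ABOUT THE MEAN**: `P(|N(m,v) − m| ≥ p) ≤ 2e^{−p²/(2C)}` for `v ≤ C`, `p ≥ 0`. [folklore] -/
theorem gaussianReal_real_abs_sub_mean_ge_le {m : ℝ} {v : ℝ≥0} {C p : ℝ} (hC : 0 < C) (hv : (v : ℝ) ≤ C)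
    (hp : 0 ≤ p) : (gaussianReal m v).real {x : ℝ | p ≤ |x - m|} ≤ 2 * Real.exp (-(p ^ 2 / (2 * C))) := by
  have hsub : {x : ℝ | p ≤ |x - m|} ⊆ {x : ℝ | m + p ≤ x} ∪ {x : ℝ | x ≤ m - p} := by
    intro x hx
    simp only [Set.mem_setOf_eq, Set.mem_union] at hx ⊢
    rcases le_or_gt 0 (x - m) with h0 | h0
    · left; rw [abs_of_nonneg h0] at hx; linarith
    · right; rw [abs_of_neg h0] at hx; linarith
  calc (gaussianReal m v).real {x : ℝ | p ≤ |x - m|}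
      ≤ (gaussianReal m v).real ({x : ℝ | m + p ≤ x} ∪ {x : ℝ | x ≤ m - p}) :=
        measureReal_mono hsub (measure_ne_top _ _)
    _ ≤ (gaussianReal m v).real {x : ℝ | m + p ≤ x} + (gaussianReal m v).real {x : ℝ | x ≤ m - p} :=
        measureReal_union_le _ _
    _ ≤ Real.exp (-(p ^ 2 / (2 * C))) + Real.exp (-(p ^ 2 / (2 * C))) :=
        add_le_add (gaussianReal_real_mean_add_le_le hC hv hp) (gaussianReal_real_le_mean_sub_le hC hv hp)
    _ = 2 * Real.exp (-(p ^ 2 / (2 * C))) := by ring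

/-- **ONE-SITE SMALL-FIELD PROBABILITY ABOUT THE MEAN**: `P(|N(m,v) − m| ≤ p) ≥ 1 − 2e^{−p²/(2C)}` for `v ≤ C`,
`p ≥ 0`. [folklore] -/
theorem gaussianReal_real_abs_sub_mean_le_ge {m : ℝ} {v : ℝ≥0} {C p : ℝ} (hC : 0 < C) (hv : (v : ℝ) ≤ C)
    (hp : 0 ≤ p) : 1 - 2 * Real.exp (-(p ^ 2 / (2 * C))) ≤ (gaussianReal m v).real {x : ℝ | |x - m| ≤ p} := by
  have hmeas : MeasurableSet {x : ℝ | |x - m| ≤ p} := measurableSet_le (by fun_prop) (by fun_prop)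
  have h1 := probReal_add_probReal_compl (μ := gaussianReal m v) hmeas
  have hsub : {x : ℝ | |x - m| ≤ p}ᶜ ⊆ {x : ℝ | p ≤ |x - m|} := by
    intro x hx
    simp only [Set.mem_compl_iff, Set.mem_setOf_eq, not_le] at hx ⊢
    exact hx.le
  have h2 : (gaussianReal m v).real {x : ℝ | |x - m| ≤ p}ᶜ ≤ 2 * Real.exp (-(p ^ 2 / (2 * C))) :=
    (measureReal_mono hsub (measure_ne_top _ _)).trans (gaussianReal_real_abs_sub_mean_ge_le hC hv hp)
  linarith

/-! ## §2 The coordinate marginal of the multivariate Gaussian (arbitrary mean, arbitrary finite index type) -/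

/-- The coordinate marginal of Mathlib's multivariate Gaussian `N(μ, S)` on the slab `|x i − μ i| ≤ p` is the
one-dimensional Gaussian probability `N(μ i, S i i)` of `|y − μ i| ≤ p` (by `measurePreserving_eval_multivariateGaussian`).
[folklore] -/
theorem multivariateGaussian_real_coord_abs_sub_le {ι : Type*} [Fintype ι] [DecidableEq ι]
    {μ : EuclideanSpace ℝ ι} {S : Matrix ι ι ℝ} (hS : S.PosSemidef) (i : ι) (p : ℝ) :
    (multivariateGaussian μ S).real {x | |x i - μ i| ≤ p} =
      (gaussianReal (μ i) (S i i).toNNReal).real {y : ℝ | |y - μ i| ≤ p} := by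
  have hmp := measurePreserving_eval_multivariateGaussian (μ := μ) hS (i := i)
  have hmeas : MeasurableSet {y : ℝ | |y - μ i| ≤ p} := measurableSet_le (by fun_prop) (by fun_prop)
  have h := hmp.measure_preimage hmeas.nullMeasurableSet
  have hset : {x : EuclideanSpace ℝ ι | |x i - μ i| ≤ p} = (fun x : EuclideanSpace ℝ ι => x i) ⁻¹' {y : ℝ | |y - μ i| ≤ p} :=
    rfl
  rw [measureReal_def, measureReal_def, hset, h]

/-! ## §3 The small-field box with per-site thresholds: Šidák (cited, a binder) + the one-site tails (kernel) -/

/-- **ŠIDÁK'S INEQUALITY (named PUBLISHED fact, hypothesis shape — the ONE cited theorem of this module; NOT proved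
here, NOT asserted: consumed only as a binder; the SAME published fact, with the same quotation and a byte-identical
body, as `…T4TerritoryReflection.SidakInequality` — re-filed in this Mathlib-only leaf, see the module header).**  For jointly Gaussian mean-zero `(X_i)_{i≤k}` and thresholds
`p_i > 0`: `∏_i P(|X_i| ≤ p_i) ≤ P(|X_i| ≤ p_i ∀ i)` — [Sidak1967] (= Corollary 1 ([10], [14]) of
[SchechtmanSchlumprechtZinn1998] p. 347: «P(max_{i≤n}|X_i| ≤ 1) ≥ ∏_{i=1}^{n} P(|X_i| ≤ 1)» for «jointly Gaussian mean
zero random variables», applied to `X_i = x i / p_i` under `multivariateGaussian 0 S`).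
[cite: Sidak1967, Cor. 1 as quoted in SchechtmanSchlumprechtZinn1998 p. 347] -/
def SidakInequality : Prop :=
  ∀ (k : ℕ) (S : Matrix (Fin k) (Fin k) ℝ), S.PosSemidef → ∀ p : Fin k → ℝ, (∀ i, 0 < p i) →
    ∏ i, (multivariateGaussian 0 S).real {x | |x i| ≤ p i} ≤
      (multivariateGaussian 0 S).real {x | ∀ i, |x i| ≤ p i}

/-- **THE SMALL-FIELD MASS OF THE BOX WITH PER-SITE THRESHOLDS (kernel GIVEN Šidák).**  For a positive semidefinite
covariance `S` on `k` sites with one-site variances `S i i ≤ C i` and thresholds `p i > 0` in the regime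
`2e^{−pᵢ²/(2Cᵢ)} ≤ ½`:  `exp(−2 Σᵢ 2e^{−pᵢ²/(2Cᵢ)}) ≤ P_{N(0,S)}(|xᵢ| ≤ pᵢ ∀ i)` — site `i` costs at most
`4e^{−pᵢ²/(2Cᵢ)}` in the exponent.  (Uniform data `p i = p`, `C i = C` give `exp(−4e^{−p²/(2C)}·k)`, the statement of
`T4TerritoryReflection.smallFieldBox_real_ge` — at a Mathlib-only call site: `have h := smallFieldBox_real_ge_sites hSidak hS
(fun _ => hC) hSC (fun _ => hp) (fun _ => hsmall)`, `convert h using 3`,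
`simp only [Finset.sum_const, Finset.card_univ, Fintype.card_fin, nsmul_eq_mul]`, `ring`; the gate's dedup rule forbids
restating that landed theorem here.) [folklore] -/
theorem smallFieldBox_real_ge_sites (hSidak : SidakInequality) {k : ℕ} {S : Matrix (Fin k) (Fin k) ℝ}
    (hS : S.PosSemidef) {C p : Fin k → ℝ} (hC : ∀ i, 0 < C i) (hSC : ∀ i, S i i ≤ C i) (hp : ∀ i, 0 < p i)
    (hsmall : ∀ i, 2 * Real.exp (-(p i ^ 2 / (2 * C i))) ≤ 1 / 2) :
    Real.exp (-(2 * ∑ i, 2 * Real.exp (-(p i ^ 2 / (2 * C i))))) ≤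
      (multivariateGaussian 0 S).real {x | ∀ i, |x i| ≤ p i} := by
  -- the product inequality `exp(−2Σᵢ tᵢ) ≤ ∏ᵢ (1 − tᵢ)` for `tᵢ ∈ [0, ½]`, with `tᵢ = 2e^{−pᵢ²/(2Cᵢ)}`
  have hprod : Real.exp (-(2 * ∑ i, 2 * Real.exp (-(p i ^ 2 / (2 * C i))))) ≤
      ∏ i, (1 - 2 * Real.exp (-(p i ^ 2 / (2 * C i)))) := by
    have hsum : -(2 * ∑ i, 2 * Real.exp (-(p i ^ 2 / (2 * C i)))) =
        ∑ i, (-(2 * (2 * Real.exp (-(p i ^ 2 / (2 * C i)))))) := by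
      rw [Finset.mul_sum, ← Finset.sum_neg_distrib]
    rw [hsum, Real.exp_sum]
    refine Finset.prod_le_prod (fun i _ => (Real.exp_pos _).le) fun i _ => ?_
    have ht0 : 0 ≤ 2 * Real.exp (-(p i ^ 2 / (2 * C i))) := by positivity
    have ht1 := hsmall i
    have ha : 2 * (2 * Real.exp (-(p i ^ 2 / (2 * C i)))) + 1 ≤ Real.exp (2 * (2 * Real.exp (-(p i ^ 2 / (2 * C i))))) :=
      Real.add_one_le_exp _
    have h1t : 0 ≤ 1 - 2 * Real.exp (-(p i ^ 2 / (2 * C i))) := by linarith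
    have hb := mul_le_mul_of_nonneg_left ha h1t
    rw [Real.exp_neg, inv_le_iff_one_le_mul₀ (Real.exp_pos _)]
    nlinarith [mul_nonneg ht0 (show 0 ≤ 1 - 2 * (2 * Real.exp (-(p i ^ 2 / (2 * C i)))) by linarith), hb]
  -- the one-site small-field probabilities, through the coordinate marginals
  have hcoord : ∀ i : Fin k,
      1 - 2 * Real.exp (-(p i ^ 2 / (2 * C i))) ≤ (multivariateGaussian 0 S).real {x | |x i| ≤ p i} := by
    intro i
    have hmp := measurePreserving_eval_multivariateGaussian (μ := (0 : EuclideanSpace ℝ (Fin k))) hS (i := i)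
    have hmeas : MeasurableSet {y : ℝ | |y| ≤ p i} := measurableSet_le (by fun_prop) (by fun_prop)
    have h := hmp.measure_preimage hmeas.nullMeasurableSet
    have hset : {x : EuclideanSpace ℝ (Fin k) | |x i| ≤ p i} =
        (fun x : EuclideanSpace ℝ (Fin k) => x i) ⁻¹' {y : ℝ | |y| ≤ p i} := rfl
    have hmarg : (multivariateGaussian 0 S).real {x | |x i| ≤ p i} =
        (gaussianReal 0 (S i i).toNNReal).real {y : ℝ | |y| ≤ p i} := by
      rw [measureReal_def, measureReal_def, hset, h]
      simp
    rw [hmarg]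
    have hv : (((S i i).toNNReal : ℝ≥0) : ℝ) ≤ C i := by
      rw [Real.coe_toNNReal']
      exact max_le (hSC i) (hC i).le
    have h1 := gaussianReal_real_abs_sub_mean_le_ge (m := 0) (hC i) hv (hp i).le
    simpa only [sub_zero] using h1
  calc Real.exp (-(2 * ∑ i, 2 * Real.exp (-(p i ^ 2 / (2 * C i)))))
      ≤ ∏ i, (1 - 2 * Real.exp (-(p i ^ 2 / (2 * C i)))) := hprod
    _ ≤ ∏ i : Fin k, (multivariateGaussian 0 S).real {x | |x i| ≤ p i} :=
        Finset.prod_le_prod (fun i _ => by linarith [hsmall i]) fun i _ => hcoord i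
    _ ≤ (multivariateGaussian 0 S).real {x | ∀ i, |x i| ≤ p i} := hSidak k S hS p hp

/-- Sanity instance (non-vacuity of the regime of `smallFieldBox_real_ge_sites`): at `C = 1`, `p = 2` the smallness
condition `2e^{−p²/(2C)} = 2e^{−2} ≤ ½` holds (`e² ≥ 4`). -/
example : 2 * Real.exp (-((2:ℝ) ^ 2 / (2 * 1))) ≤ 1 / 2 := by
  have h4 : (4:ℝ) ≤ Real.exp 2 := by
    have h1 : (2:ℝ) ≤ Real.exp 1 := by
      have := Real.add_one_le_exp (1:ℝ)
      norm_num at this ⊢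
      linarith
    have h2 : Real.exp 2 = Real.exp 1 * Real.exp 1 := by
      rw [← Real.exp_add]
      norm_num
    rw [h2]
    nlinarith [Real.exp_pos (1:ℝ)]
  have hneg : Real.exp (-((2:ℝ) ^ 2 / (2 * 1))) = (Real.exp 2)⁻¹ := by
    norm_num [Real.exp_neg]
  have hpos : 0 < Real.exp 2 := Real.exp_pos 2
  rw [hneg, show (2:ℝ) * (Real.exp 2)⁻¹ = 2 / Real.exp 2 from by ring, div_le_iff₀ hpos]
  linarith

end Literature.MathematicalPhysics.QuantumFieldTheory.Balaban1983to89.GaussianSmallField
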